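import Summits.HubbardSuperconductivity.HubbardSuperconductivity.Theses.DeformationLadder
import Summits.HubbardSuperconductivity.HubbardSuperconductivity.Theorems.DeformationLadderLowEnergyRigidityDefs
import Summits.HubbardSuperconductivity.HubbardSuperconductivity.Theorems.DeformationLadderLowEnergyRigidityInheritance
import Summits.HubbardSuperconductivity.HubbardSuperconductivity.Theorems.DeformationLadderLowEnergyRigidityMesoPenalised
import Summits.HubbardSuperconductivity.HubbardSuperconductivity.Theorems.DeformationLadderLadderThesisRigidityReduction
import Summits.HubbardSuperconductivity.HubbardSuperconductivity.Theorems.DeformationLadderLadderThesisNormalForms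
import Literature.MathematicalPhysics.QuantumLattice.PairFieldMomentum
import Mathlib.Analysis.Matrix.PosDef

/-!
# Sketch (ideator 5, round 2) — crux `LadderThesis` (stmt-HubbardSuperconductivity-1890)
# card `penalty-selects-the-adversary`

The penalty's own variational principle discharges the every-state quantifier of `S⁺`:
`LadderThesis ⇐ CondensationGapWith (A′, thermodynamic, shared with the 1892 inheritance cut) ∧
PenalisedWindowBound (B′: ONE sector ground state of the penalised torus `H_L + (s/L⁴)Δ_dᴴΔ_d`
has mesoscopic-window pair weight at nonzero momenta ≤ σ)`.

Contents (all over tree vocabulary; `lean check` target rc 0, no `sorry`):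
* `CondensationGapWith`, `PenalisedWindowBound`, `TwoPenaltyComparison`, `PenalisedGoldstoneShape` — Props;
* `ladderThesis_of_condensationGap_of_penalisedWindowBound` — FIRST LEMMA (the composition), PROVED;
* `ladderThesis_of_condensationGap_of_twoPenaltyComparison` — eigenvector-free energy form, PROVED;
* `groundStateInterpolation` — the abstract KLS two-step `‖u‖⁴ ≤ m₋₁ · m₁` (Cauchy–Schwarz in the
  `M`-semi-inner product), PROVED: the engine that turns a Gaussian-domination-shaped pair
  susceptibility ceiling for the penalised ground state into `PenalisedWindowBound`.
-/

namespace Summit.HubbardSuperconductivity.HubbardSuperconductivity.Cruxes.LadderThesis.Ideator5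

set_option linter.dupNamespace false

open Matrix
open scoped ComplexOrder
open Literature.MathematicalPhysics.QuantumLattice Literature.Probability.LatticeModels
open Summit.HubbardSuperconductivity.HubbardSuperconductivity.Theses.DeformationLadder
open Summit.HubbardSuperconductivity.HubbardSuperconductivity.Theorems
open Summit.HubbardSuperconductivity.HubbardSuperconductivity.Theorems.LowEnergyRigidity
open Summit.HubbardSuperconductivity.HubbardSuperconductivity.Theorems.DeformationLadder

/-- The summit's electron number `N_L = 2⌊(1-δ)L²/2⌋`. -/
noncomputable abbrev statN (δ : ℝ) (L : ℕ) : ℕ := 2 * ⌊(1 - δ) * (L : ℝ) ^ 2 / 2⌋₊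

/-- **(A′) Condensation gap with explicit parameters** `(θ, ε, R)` at `(U, δ)`: for all large even
`L`, every unit sector vector with block pair order `Re⟨𝓜_R⟩/(L²R⁴) ≤ θ` pays extensive energy
`≥ εL²` above the sector bottom. (`CondensationGapAt U δ` of the 1892 inheritance cut is
`∃ θ>0, ∃ R₀, ∀ R ≥ R₀, ∃ ε>0, CondensationGapWith U δ θ ε R`.) Thermodynamic; shared. -/
def CondensationGapWith (U δ θ ε : ℝ) (R : ℕ) : Prop :=
  ∃ L₀ : ℕ, ∀ (L : ℕ) [NeZero L], L₀ ≤ L → Even L →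
    ∀ φ : Fock (Orb (FermionTorus 2 L)),
      φ ∈ szSector (Λ := FermionTorus 2 L) (statN δ L) 0 →
      star φ ⬝ᵥ φ = 1 →
      (expect (mesoOp L R) φ).re / ((L : ℝ) ^ 2 * (R : ℝ) ^ 4) ≤ θ →
      (hubbardTorus 2 L 1 U).minEnergyOn (szSector (Λ := FermionTorus 2 L) (statN δ L) 0) +
          ε * (L : ℝ) ^ 2 ≤
        (star φ ⬝ᵥ Matrix.mulVec (hubbardTorus 2 L 1 U) φ).re

/-- **(B′) Penalised window bound** — the card's residual: for all large even `L`, SOME normalised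
`(N_L, S^z=0)`-sector ground state `φ` of the PENALISED torus `H_L + (s/L⁴)Δ_dᴴΔ_d` has
mesoscopic-window excess (block pair-order density minus LRO density = `d`-wave pair weight at
NONZERO momenta inside the Fejér window of scale `R`) at most `σ`. One Hamiltonian, one state,
one equal-time two-point functional; no quantifier over excited states. -/
def PenalisedWindowBound (U δ s σ : ℝ) (R : ℕ) : Prop :=
  ∃ L₀ : ℕ, ∀ (L : ℕ) [NeZero L], L₀ ≤ L → Even L →
    ∃ φ : Fock (Orb (FermionTorus 2 L)), star φ ⬝ᵥ φ = 1 ∧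
      IsGroundStateInSector (hubbardTorus 2 L 1 U + ((s / (L : ℝ) ^ 4 : ℝ) : ℂ) •
        ((pairField dWaveFormFactor L)ᴴ * pairField dWaveFormFactor L)) (statN δ L) 0 φ ∧
      (expect (mesoOp L R) φ).re / ((L : ℝ) ^ 2 * (R : ℝ) ^ 4) -
        (expect ((pairField dWaveFormFactor L)ᴴ * pairField dWaveFormFactor L) φ).re /
          (L : ℝ) ^ 4 ≤ σ

/-- **(B′ₑ) Two-penalty comparison** — the eigenvector-free energy form of the residual: penalising
the WHOLE mesoscopic window (`(s/(L²R⁴))·𝓜_R`, Fejér-flat near `k = 0`, a sum of LOCAL positive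
terms) costs at most `s·σ` more sector ground energy than penalising the zero mode alone
(`(s/L⁴)·Δ_dᴴΔ_d`). Two `minEnergyOn`s of explicit matrices; implied by (B′) (trial state). -/
def TwoPenaltyComparison (U δ s σ : ℝ) (R : ℕ) : Prop :=
  ∃ L₀ : ℕ, ∀ (L : ℕ) [NeZero L], L₀ ≤ L → Even L →
    (hubbardTorus 2 L 1 U + ((s / ((L : ℝ) ^ 2 * (R : ℝ) ^ 4) : ℝ) : ℂ) • mesoOp L R).minEnergyOn
        (szSector (Λ := FermionTorus 2 L) (statN δ L) 0) ≤
      (hubbardTorus 2 L 1 U + ((s / (L : ℝ) ^ 4 : ℝ) : ℂ) •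
          ((pairField dWaveFormFactor L)ᴴ * pairField dWaveFormFactor L)).minEnergyOn
        (szSector (Λ := FermionTorus 2 L) (statN δ L) 0) + s * σ

/-- **Penalised Goldstone shape** (the KLS-shaped sufficient condition for (B′), window form of
route KacWindowPenalty's `WindowInfraredBound` transplanted `H ↦ H_s`): some sector ground state of
the penalised torus has pair structure factor `S_φ(m)·|q_m| ≤ A` on the punctured window
`0 < |q_m| ≤ ε₀`. The tree's `windowSum_le_of_goldstoneShape` turns it into a window-sum bound. -/
def PenalisedGoldstoneShape (U δ s A ε₀ : ℝ) : Prop :=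
  ∃ L₀ : ℕ, ∀ (L : ℕ) [NeZero L], L₀ ≤ L → Even L →
    ∃ φ : Fock (Orb (FermionTorus 2 L)), star φ ⬝ᵥ φ = 1 ∧
      IsGroundStateInSector (hubbardTorus 2 L 1 U + ((s / (L : ℝ) ^ 4 : ℝ) : ℂ) •
        ((pairField dWaveFormFactor L)ᴴ * pairField dWaveFormFactor L)) (statN δ L) 0 φ ∧
      ∀ m : TorusSite 2 L, m ≠ 0 → momentumNormSq L m ≤ ε₀ ^ 2 →
        pairStructureFactor dWaveFormFactor L φ m * Real.sqrt (momentumNormSq L m) ≤ A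

/-! ### The abstract KLS two-step -/

section Abstract

variable {n : Type*} [Fintype n]

/-- **Ground-state interpolation (`m₀² ≤ m₋₁·m₁`)**: for a positive semidefinite `M` and any `w`,
with `u := M w`, `⟨u,u⟩² ≤ ⟨w, M w⟩ · ⟨u, M u⟩` — Cauchy–Schwarz for the semi-inner product
`⟨·, M ·⟩`. Physical instance: `M = (H_s − μN̂ − E)` on the `(N_L−2)`-sector, `u = Δ_d(m)φ_s`,
`w` its reduced resolvent: weight² ≤ (static pair susceptibility) × (double-commutator f-sum). -/
theorem groundStateInterpolation {M : Matrix n n ℂ} (hM : M.PosSemidef) (w : n → ℂ) :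
    ((star (M *ᵥ w) ⬝ᵥ (M *ᵥ w)).re) ^ 2 ≤
      (star w ⬝ᵥ (M *ᵥ w)).re * (star (M *ᵥ w) ⬝ᵥ (M *ᵥ (M *ᵥ w))).re := by
  have hherm : Mᴴ = M := hM.1
  have hnn : ∀ v : n → ℂ, 0 ≤ (star v ⬝ᵥ (M *ᵥ v)).re := fun v =>
    (Complex.nonneg_iff.1 (hM.dotProduct_mulVec_nonneg v)).1
  have him : ∀ v : n → ℂ, (star v ⬝ᵥ (M *ᵥ v)).im = 0 := fun v =>
    (Complex.nonneg_iff.1 (hM.dotProduct_mulVec_nonneg v)).2.symm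
  -- `⟨Mw, v⟩ = ⟨w, M v⟩` (Hermitian)
  have kk : ∀ v : n → ℂ, star (M *ᵥ w) ⬝ᵥ v = star w ⬝ᵥ (M *ᵥ v) := fun v => by
    rw [star_mulVec, ← dotProduct_mulVec, hherm]
  -- the three real numbers
  set a : ℝ := (star w ⬝ᵥ (M *ᵥ w)).re with ha
  set b : ℝ := (star (M *ᵥ w) ⬝ᵥ (M *ᵥ w)).re with hb
  set c : ℝ := (star (M *ᵥ w) ⬝ᵥ (M *ᵥ (M *ᵥ w))).re with hc
  have hwMMw : (star w ⬝ᵥ (M *ᵥ (M *ᵥ w))).re = b := by rw [← kk]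
  -- nonnegativity of the form along the real line `w - t • Mw`
  have hquad : ∀ t : ℝ, 0 ≤ a - 2 * t * b + t ^ 2 * c := by
    intro t
    have h := hnn (w - (t : ℂ) • (M *ᵥ w))
    have hexp : star (w - (t : ℂ) • (M *ᵥ w)) ⬝ᵥ (M *ᵥ (w - (t : ℂ) • (M *ᵥ w))) =
        star w ⬝ᵥ (M *ᵥ w) - (t : ℂ) * (star w ⬝ᵥ (M *ᵥ (M *ᵥ w))) -
          (t : ℂ) * (star (M *ᵥ w) ⬝ᵥ (M *ᵥ w)) +
          (t : ℂ) * (t : ℂ) * (star (M *ᵥ w) ⬝ᵥ (M *ᵥ (M *ᵥ w))) := by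
      simp only [mulVec_sub, mulVec_smul, star_sub, star_smul, sub_dotProduct, dotProduct_sub,
        smul_dotProduct, dotProduct_smul, smul_eq_mul, Complex.star_def, Complex.conj_ofReal]
      ring
    have hre : (star (w - (t : ℂ) • (M *ᵥ w)) ⬝ᵥ (M *ᵥ (w - (t : ℂ) • (M *ᵥ w)))).re =
        a - 2 * t * b + t ^ 2 * c := by
      rw [hexp]
      simp only [Complex.add_re, Complex.sub_re, Complex.mul_re,
        Complex.ofReal_re, Complex.ofReal_im, mul_zero, sub_zero, zero_mul]
      rw [hwMMw, ← ha, ← hb, ← hc, him (M *ᵥ w)]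
      ring
    rw [hre] at h
    exact h
  have hc0 : 0 ≤ c := hnn (M *ᵥ w)
  rcases eq_or_lt_of_le hc0 with hc00 | hcpos
  · -- c = 0 forces b = 0
    have hbz : b = 0 := by
      by_contra hbne
      have h1 := hquad ((a + 1) / (2 * b))
      rw [← hc00, mul_zero, add_zero] at h1
      have : a - 2 * ((a + 1) / (2 * b)) * b = -1 := by field_simp; ring
      linarith
    rw [hbz, ← hc00]
    norm_num
  · have h1 := hquad (b / c)
    have : a - 2 * (b / c) * b + (b / c) ^ 2 * c = a - b ^ 2 / c := by
      field_simp; ring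
    rw [this] at h1
    have h2 : b ^ 2 / c ≤ a := by linarith
    rw [div_le_iff₀ hcpos] at h2
    linarith

end Abstract

/-! ### The composition (FIRST LEMMA) -/

/-- Helper: the `H_L`-energy of a normalised sector ground state of the penalised torus is at most
`minEnergyOn H_L K + 32 s` (penalty nonnegative, penalised bottom ≤ bottom + 32 s). -/
theorem re_energy_le_of_penalisedGroundState {U s : ℝ} (hs : 0 ≤ s) {L : ℕ} [NeZero L] {N : ℕ}
    {φ : Fock (Orb (FermionTorus 2 L))} (hφ1 : star φ ⬝ᵥ φ = 1)
    (hGS : IsGroundStateInSector (hubbardTorus 2 L 1 U + ((s / (L : ℝ) ^ 4 : ℝ) : ℂ) •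
      ((pairField dWaveFormFactor L)ᴴ * pairField dWaveFormFactor L)) N 0 φ) :
    (star φ ⬝ᵥ Matrix.mulVec (hubbardTorus 2 L 1 U) φ).re ≤
      (hubbardTorus 2 L 1 U).minEnergyOn (szSector (Λ := FermionTorus 2 L) N 0) + 32 * s := by
  obtain ⟨hmem, -, heig⟩ := hGS
  set P := (pairField dWaveFormFactor L)ᴴ * pairField dWaveFormFactor L with hP
  set H := hubbardTorus 2 L 1 U with hH
  set K := szSector (Λ := FermionTorus 2 L) N 0 with hK
  have hL4 : (0 : ℝ) < (L : ℝ) ^ 4 := by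
    have : (0 : ℝ) < L := by exact_mod_cast Nat.pos_of_ne_zero (NeZero.ne L)
    positivity
  have hEs : (star φ ⬝ᵥ ((H + ((s / (L : ℝ) ^ 4 : ℝ) : ℂ) • P) *ᵥ φ)).re =
      (H + ((s / (L : ℝ) ^ 4 : ℝ) : ℂ) • P).minEnergyOn K := by
    rw [heig, dotProduct_smul, hφ1, smul_eq_mul, mul_one, Complex.ofReal_re]
  rw [add_mulVec, dotProduct_add, Complex.add_re, smul_mulVec, dotProduct_smul, smul_eq_mul,
    Complex.re_ofReal_mul] at hEs
  have hpen := minEnergyOn_penalised_le L U hs K ⟨φ, hmem, hφ1⟩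
  have hPnn : 0 ≤ (star φ ⬝ᵥ (P *ᵥ φ)).re := re_expect_pairPenalty_nonneg L φ
  have hnn : 0 ≤ s / (L : ℝ) ^ 4 * (star φ ⬝ᵥ (P *ᵥ φ)).re :=
    mul_nonneg (div_nonneg hs hL4.le) hPnn
  linarith

/-- **FIRST LEMMA — the composition `A′ ∧ B′ ⇒ LadderThesis`.** At `(U, δ)` with `U > 0`,
`δ ∈ (0, 1/2)`: a condensation gap with parameters `(θ, ε, R)` and a penalised window bound with
slack `σ < θ` at penalty strength `s > 0` and the same block scale `R ≥ 1` give `LadderThesis` with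
`a = θ − σ`. Proof: the penalised ground state `φ` of (B′) has `H_L`-energy `≤ E₀ + 32 s < E₀ + εL²`
(large `L`), so by the contrapositive of (A′) its block order exceeds `θ`; Fejér domination is not
even needed — (B′) subtracts the window excess directly: `LRO(φ) ≥ θ − σ`. -/
theorem ladderThesis_of_condensationGap_of_penalisedWindowBound {U δ θ ε s σ : ℝ} {R : ℕ}
    (hU : 0 < U) (hδ : δ ∈ Set.Ioo (0:ℝ) (1 / 2)) (hε : 0 < ε) (hs : 0 < s) (hσθ : σ < θ)
    (hA : CondensationGapWith U δ θ ε R) (hB : PenalisedWindowBound U δ s σ R) :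
    LadderThesis := by
  obtain ⟨LA, hA⟩ := hA
  obtain ⟨LB, hB⟩ := hB
  obtain ⟨L₁, hL₁⟩ : ∃ L₁ : ℕ, 32 * s / ε < (L₁ : ℝ) := exists_nat_gt _
  refine ⟨U, hU, δ, hδ, s, hs, θ - σ, by linarith, max LA (max LB (max L₁ 1)), ?_⟩
  intro L _ hL hLe
  have hLA : LA ≤ L := le_trans (le_max_left _ _) hL
  have hLB : LB ≤ L := le_trans ((le_max_left _ _).trans (le_max_right _ _)) hL
  have hL1 : L₁ ≤ L :=
    le_trans (((le_max_left _ _).trans (le_max_right _ _)).trans (le_max_right _ _)) hL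
  have hLone : 1 ≤ L :=
    le_trans (((le_max_right _ _).trans (le_max_right _ _)).trans (le_max_right _ _)) hL
  obtain ⟨φ, hφ1, hGS, hwin⟩ := hB L hLB hLe
  refine ⟨φ, hφ1, hGS, ?_⟩
  have hmem : φ ∈ szSector (Λ := FermionTorus 2 L) (statN δ L) 0 := hGS.1
  have hHle := re_energy_le_of_penalisedGroundState hs.le hφ1 hGS
  -- 32 s < ε L²
  have hLr : (1 : ℝ) ≤ (L : ℝ) := by exact_mod_cast hLone
  have h32 : 32 * s < ε * (L : ℝ) ^ 2 := by
    have h1 : 32 * s / ε < (L : ℝ) := lt_of_lt_of_le hL₁ (by exact_mod_cast hL1)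
    rw [div_lt_iff₀ hε] at h1
    have hL1r : (0 : ℝ) ≤ (L : ℝ) - 1 := by linarith
    have h2 : (L : ℝ) * ε ≤ ε * (L : ℝ) ^ 2 := by
      nlinarith [mul_nonneg hε.le hL1r, hLr]
    linarith
  -- contrapositive of (A′)
  have hmeso : θ < (expect (mesoOp L R) φ).re / ((L : ℝ) ^ 2 * (R : ℝ) ^ 4) := by
    by_contra hle
    push Not at hle
    have h := hA L hLA hLe φ hmem hφ1 hle
    linarith
  linarith

/-- **Energy form of the composition `A′ ∧ B′ₑ ⇒ LadderThesis`** (eigenvector-free): the sector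
bottom of the window-penalised torus is `≥ E₀ + s·min(θ, εL²/s) = E₀ + sθ` for large `L`
(every unit trial vector either is block-condensed, paying `sθ` to the window penalty by Fejér
domination `𝓜_R ≥ 0`… precisely `Re⟨𝓜_R⟩/(L²R⁴) > θ`, or pays `εL² ≥ sθ` in `H_L`-energy), so
(B′ₑ) gives the uniform penalty gap `≥ s(θ − σ)`, which is `LadderThesis` by the landed normal form
`ladderThesis_of_penaltyGap` (constants degrade inside that lemma). -/
theorem ladderThesis_of_condensationGap_of_twoPenaltyComparison {U δ θ ε s σ : ℝ} {R : ℕ}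
    (hU : 0 < U) (hδ : δ ∈ Set.Ioo (0:ℝ) (1 / 2)) (hε : 0 < ε) (hs : 0 < s) (hσθ : σ < θ)
    (hA : CondensationGapWith U δ θ ε R) (hB : TwoPenaltyComparison U δ s σ R) :
    LadderThesis := by
  obtain ⟨LA, hA⟩ := hA
  obtain ⟨LB, hB⟩ := hB
  obtain ⟨L₁, hL₁⟩ : ∃ L₁ : ℕ, s * θ / ε < (L₁ : ℝ) := exists_nat_gt _
  refine ladderThesis_of_penaltyGap ⟨U, hU, δ, hδ, s, hs, θ - σ, by linarith,
    max LA (max LB (max L₁ 1)), ?_⟩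
  intro L _ hL hLe
  have hLA : LA ≤ L := le_trans (le_max_left _ _) hL
  have hLB : LB ≤ L := le_trans ((le_max_left _ _).trans (le_max_right _ _)) hL
  have hL1 : L₁ ≤ L :=
    le_trans (((le_max_left _ _).trans (le_max_right _ _)).trans (le_max_right _ _)) hL
  have hLone : 1 ≤ L :=
    le_trans (((le_max_right _ _).trans (le_max_right _ _)).trans (le_max_right _ _)) hL
  set H := hubbardTorus 2 L 1 U with hH
  set K := szSector (Λ := FermionTorus 2 L) (statN δ L) 0 with hK
  set W := ((s / ((L : ℝ) ^ 2 * (R : ℝ) ^ 4) : ℝ) : ℂ) • mesoOp L R with hW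
  -- s θ ≤ ε L²
  have hLr : (1 : ℝ) ≤ (L : ℝ) := by exact_mod_cast hLone
  have hsθ : s * θ ≤ ε * (L : ℝ) ^ 2 := by
    have h1 : s * θ / ε < (L : ℝ) := lt_of_lt_of_le hL₁ (by exact_mod_cast hL1)
    rw [div_lt_iff₀ hε] at h1
    have hL1r : (0 : ℝ) ≤ (L : ℝ) - 1 := by linarith
    have h2 : (L : ℝ) * ε ≤ ε * (L : ℝ) ^ 2 := by
      nlinarith [mul_nonneg hε.le hL1r, hLr]
    linarith
  -- lower bound on the window-penalised bottom: E₀ + sθ ≤ minEnergyOn (H + W) K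
  have hδ' : (-1 : ℝ) ≤ δ := by linarith [hδ.1]
  obtain ⟨ψ₀, hψ₀K, hψ₀⟩ := exists_unit_mem_szSector L U δ hδ'
  have hlow : H.minEnergyOn K + s * θ ≤ (H + W).minEnergyOn K := by
    refine le_csInf ⟨_, ψ₀, hψ₀K, hψ₀, rfl⟩ ?_
    rintro E ⟨ψ, hψK, hψ, rfl⟩
    rw [add_mulVec, dotProduct_add, Complex.add_re, hW, smul_mulVec, dotProduct_smul, smul_eq_mul,
      Complex.re_ofReal_mul]
    have hbot := minEnergyOn_le_re_rayleigh H K hψK hψ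
    by_cases hcond : (expect (mesoOp L R) ψ).re / ((L : ℝ) ^ 2 * (R : ℝ) ^ 4) ≤ θ
    · -- uncondensed: pays ε L² ≥ s θ in H-energy; window penalty ≥ 0
      have hpay := hA L hLA hLe ψ hψK hψ hcond
      have hMnn : 0 ≤ (star ψ ⬝ᵥ (mesoOp L R *ᵥ ψ)).re := by
        have h := (posSemidef_mesoOp L R).re_dotProduct_nonneg ψ
        simpa using h
      have hcoef : 0 ≤ s / ((L : ℝ) ^ 2 * (R : ℝ) ^ 4) := by positivity
      have := mul_nonneg hcoef hMnn
      linarith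
    · -- condensed: the window penalty alone pays s θ
      push Not at hcond
      rcases Nat.eq_zero_or_pos R with hR0 | hRpos
      · -- R = 0: mesoOp = 0, so the block density is 0 ≤ θ? then hcond : θ < 0 contradicts σ<θ? no:
        -- we only know σ < θ; but with R = 0 the density is 0, so hcond says θ < 0, and then
        -- s θ < 0 ≤ (penalty term), fine.
        subst hR0
        have hz : (expect (mesoOp L 0) ψ).re / ((L : ℝ) ^ 2 * ((0:ℕ) : ℝ) ^ 4) = 0 := by simp
        rw [hz] at hcond
        have hMz : (star ψ ⬝ᵥ (mesoOp L 0 *ᵥ ψ)).re = 0 := by simp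
        rw [hMz, mul_zero, add_zero]
        nlinarith
      · have hpos : (0 : ℝ) < (L : ℝ) ^ 2 * (R : ℝ) ^ 4 := by
          have hR' : (0 : ℝ) < (R : ℝ) := by exact_mod_cast hRpos
          positivity
        have hexp : (expect (mesoOp L R) ψ).re = (star ψ ⬝ᵥ (mesoOp L R *ᵥ ψ)).re := rfl
        rw [hexp, lt_div_iff₀ hpos] at hcond
        have : s * θ ≤ s / ((L : ℝ) ^ 2 * (R : ℝ) ^ 4) * (star ψ ⬝ᵥ (mesoOp L R *ᵥ ψ)).re := by
          rw [div_mul_eq_mul_div, le_div_iff₀ hpos]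
          nlinarith [hs.le]
        linarith
  have hTPC := hB L hLB hLe
  -- penalty gap
  have : H.minEnergyOn K + (θ - σ) * s ≤
      (H + ((s / (L : ℝ) ^ 4 : ℝ) : ℂ) •
        ((pairField dWaveFormFactor L)ᴴ * pairField dWaveFormFactor L)).minEnergyOn K := by
    nlinarith [hlow, hTPC]
  linarith

/-- (B′) implies (B′ₑ): the penalised ground state of (B′) is a trial vector for the window-penalised
torus. -/
theorem twoPenaltyComparison_of_penalisedWindowBound {U δ s σ : ℝ} {R : ℕ} (hs : 0 ≤ s)
    (hB : PenalisedWindowBound U δ s σ R) : TwoPenaltyComparison U δ s σ R := by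
  obtain ⟨LB, hB⟩ := hB
  refine ⟨LB, fun L _ hL hLe => ?_⟩
  obtain ⟨φ, hφ1, hGS, hwin⟩ := hB L hL hLe
  obtain ⟨hmem, -, heig⟩ := hGS
  set P := (pairField dWaveFormFactor L)ᴴ * pairField dWaveFormFactor L with hP
  set H := hubbardTorus 2 L 1 U with hH
  set K := szSector (Λ := FermionTorus 2 L) (statN δ L) 0 with hK
  have hL0 : (0 : ℝ) < (L : ℝ) := by exact_mod_cast Nat.pos_of_ne_zero (NeZero.ne L)
  have hL4 : (0 : ℝ) < (L : ℝ) ^ 4 := by positivity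
  -- penalised bottom = energy of φ
  have hEs : (star φ ⬝ᵥ ((H + ((s / (L : ℝ) ^ 4 : ℝ) : ℂ) • P) *ᵥ φ)).re =
      (H + ((s / (L : ℝ) ^ 4 : ℝ) : ℂ) • P).minEnergyOn K := by
    rw [heig, dotProduct_smul, hφ1, smul_eq_mul, mul_one, Complex.ofReal_re]
  rw [add_mulVec, dotProduct_add, Complex.add_re, smul_mulVec, dotProduct_smul, smul_eq_mul,
    Complex.re_ofReal_mul] at hEs
  -- trial vector φ for H + W
  have htrial := minEnergyOn_le_re_rayleigh
    (H + ((s / ((L : ℝ) ^ 2 * (R : ℝ) ^ 4) : ℝ) : ℂ) • mesoOp L R) K hmem hφ1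
  rw [add_mulVec, dotProduct_add, Complex.add_re, smul_mulVec, dotProduct_smul, smul_eq_mul,
    Complex.re_ofReal_mul] at htrial
  -- window excess bound, multiplied by s
  rcases Nat.eq_zero_or_pos R with hR0 | hRpos
  · subst hR0
    have hMz : (star φ ⬝ᵥ (mesoOp L 0 *ᵥ φ)).re = 0 := by simp
    have hz : (expect (mesoOp L 0) φ).re / ((L : ℝ) ^ 2 * ((0:ℕ) : ℝ) ^ 4) = 0 := by simp
    rw [hz] at hwin
    rw [hMz, mul_zero, add_zero] at htrial
    have hPnn : 0 ≤ (star φ ⬝ᵥ (P *ᵥ φ)).re := re_expect_pairPenalty_nonneg L φ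
    have hlro : (expect P φ).re / (L : ℝ) ^ 4 = (star φ ⬝ᵥ (P *ᵥ φ)).re / (L : ℝ) ^ 4 := rfl
    rw [hlro] at hwin
    -- 0 - lro ≤ σ ⇒ -σ ≤ lro; and s/L⁴ ⟨P⟩ = s · lro
    have h1 : s / (L : ℝ) ^ 4 * (star φ ⬝ᵥ (P *ᵥ φ)).re =
        s * ((star φ ⬝ᵥ (P *ᵥ φ)).re / (L : ℝ) ^ 4) := by ring
    have h2 : -σ ≤ (star φ ⬝ᵥ (P *ᵥ φ)).re / (L : ℝ) ^ 4 := by linarith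
    nlinarith [h1, h2, hs]
  · have hpos : (0 : ℝ) < (L : ℝ) ^ 2 * (R : ℝ) ^ 4 := by
      have hR' : (0 : ℝ) < (R : ℝ) := by exact_mod_cast hRpos
      positivity
    have hmeso : (expect (mesoOp L R) φ).re = (star φ ⬝ᵥ (mesoOp L R *ᵥ φ)).re := rfl
    have hlro : (expect P φ).re = (star φ ⬝ᵥ (P *ᵥ φ)).re := rfl
    rw [hmeso, hlro] at hwin
    have h1 : s / ((L : ℝ) ^ 2 * (R : ℝ) ^ 4) * (star φ ⬝ᵥ (mesoOp L R *ᵥ φ)).re =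
        s * ((star φ ⬝ᵥ (mesoOp L R *ᵥ φ)).re / ((L : ℝ) ^ 2 * (R : ℝ) ^ 4)) := by ring
    have h2 : s / (L : ℝ) ^ 4 * (star φ ⬝ᵥ (P *ᵥ φ)).re =
        s * ((star φ ⬝ᵥ (P *ᵥ φ)).re / (L : ℝ) ^ 4) := by ring
    have h3 := mul_le_mul_of_nonneg_left hwin hs
    rw [mul_sub] at h3
    linarith [h1, h2, h3, htrial, hEs]

end Summit.HubbardSuperconductivity.HubbardSuperconductivity.Cruxes.LadderThesis.Ideator5
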